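import Summits.QuantumAdvantage.QuantumAdvantage.Theorems.CharDialFieldColB
import Summits.QuantumAdvantage.QuantumAdvantage.Theorems.CharDialFieldColC
import Summits.QuantumAdvantage.QuantumAdvantage.Theorems.CharDialSegmentMovesD
import HarnessLib

/-!
# CharDial / JLinPeel — FIELD COLUMNS, part D: `fieldY` is on the HIGH side; the combined statement
(route `CharDial`, item 32604; lens-6 node g18 §10.4 (b))

* `exists_col_jump` — for `α ∉ {0, 1}` SOME column of the table jumps at every adjacent pair `(s, s+1)`:
  `α^(s+2) − α^(s+1) = α^(s+1)(α − 1) ≠ 0` has a non-zero coordinate (`eq_of_coord_eq`).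
* `fieldY_flip` — swap law at a full-pattern cut (tree `SegMove.form_swap`): an adjacent swap of two different bits at a pair where
  column `r` jumps changes the output of every cut of column `r` that accepted the input.
* ★ `swapMass_fieldY_ge` — at such a pair `2·swapMass(s) ≥ K·2ⁿ`: every input with `u_s ≠ u_{s+1}` (at least `2ⁿ⁻¹` of them,
  `SegMove.two_pow_le_two_mul_card_ne`) is swap-sensitive for the `K` cuts `cutAt r k (col_r · u)`, `k < K` — NO residue counting is
  needed (contrast `swapMass_denseY_ge`): the residue of the accepting cut is chosen per input.
* ★★ `not_low_fieldY` — `fieldY p n α` is on the HIGH side of the variation dial at threshold `4(log₂ n + 1)` (the annex's `¬ LowVar dialB`,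
  inlined with the tree's `SegMove.lowPositions`): with `K = 8(log₂ n + 1) + 1` cuts per column at most ONE position (`n − 1`) is low.
* `generic_ne_zero` / `generic_ne_one` — a generic `α` (part B's hypothesis) is `≠ 0` (level `m = 1`) and, once `p ≤ log₂ n`, `≠ 1`
  (level `m = p`: `p` ones sum to `0`, `CharP`); `eventually_big` / `eventually_misc` — the budgets hold for `n ≥ n₀(p)`
  (`DWalk.const_mul_logPow_le'`).
* ★★★ `fieldY_high_sparse_mask_eventually` (every prime `p ≥ 5`, all `n ≥ n₀(p)`): some `fieldY p n α` is canonically junta-free, on the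
  HIGH side, and in EVERY `log₂ n`-junta presentation escapes BOTH the sparse-free-set dial's hypothesis (part C) AND the masked-block
  (hence block- and null-) dial's hypothesis (part B) — each inlined verbatim from the annex.

What this is NOT: the robust RANK escape (`¬ SpanHyp`: the presented forms of the non-constant cuts do not lie in a `cubeRate n`-dimensional
span) — the one remaining input for membership of `fieldY` in the hypothesis class of the fifth residual (node §10.4 (c), g19; the
constant-column PREFIX cuts `p·q`, `q ≡ R (mod R+1)`, `q < sepM`, are in the design for it).  Prop-free, 0 sorry.
-/

set_option autoImplicit false

namespace Summit.QuantumAdvantage.AdviceFreeQNC0.JLinPeel.FieldCol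

open Finset MaskDial BlockDial

/-! #### (7) the HIGH side: every position `s ≤ n − 2` of `fieldY p n α` (`α ∉ {0,1}`) has large swap mass -/
section High
variable (p : ℕ) [hp : Fact p.Prime]
open SegMove

/-- **a column jumps at every adjacent pair** when `α ∉ {0, 1}`: `α^(s+2) − α^(s+1) = α^(s+1)(α − 1) ≠ 0` has a non-zero coordinate. -/
theorem exists_col_jump (n : ℕ) (α : GaloisField p (rk n)) (h0 : α ≠ 0) (h1 : α ≠ 1) (s t : Fin n) (hst : t.val = s.val + 1) :
    ∃ r : Fin (rk n + 1), col p n α r t - col p n α r s ≠ 0 := by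
  by_contra hnot
  push Not at hnot
  have hpow : α ^ (t.val + 1) = α ^ (s.val + 1) := by
    apply eq_of_coord_eq p n
    intro r
    have h := hnot ⟨r.val, Nat.lt_succ_of_lt r.isLt⟩
    rw [col_cast, col_cast] at h
    unfold pcol at h
    exact sub_eq_zero.mp h
  rw [hst, pow_succ] at hpow
  have h2 : α ^ (s.val + 1) * (α - 1) = 0 := by rw [mul_sub, mul_one, hpow, sub_self]
  rcases mul_eq_zero.mp h2 with h | h
  · exact h0 ((pow_eq_zero_iff (Nat.succ_ne_zero _)).mp h)
  · exact h1 (sub_eq_zero.mp h)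

/-- **swap law at a full-pattern cut**: an adjacent swap of two different bits at a pair where column `r` jumps changes the output of
every cut of column `r` that accepted the input. -/
theorem fieldY_flip (n K : ℕ) (hbig : p * (NullDial.sepM p n + (rk n + 1) * (K + 2)) ≤ n + 1) (α : GaloisField p (rk n))
    (r : Fin (rk n + 1)) (k : Fin K) (c : Fin p) (u : Fin n → Bool) (s t : Fin n) (hst : t.val = s.val + 1) (hne : u s ≠ u t)
    (hd : col p n α r t - col p n α r s ≠ 0) (hu : ((c.val : ℕ) : ZMod p) = form (col p n α r) u) :
    fieldY p n α (cutAt p n K hbig r k c) (segCompl u s.val (s.val + 2)) ≠ fieldY p n α (cutAt p n K hbig r k c) u := by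
  rw [fieldY_cutAt, fieldY_cutAt]
  change decide (((c.val : ℕ) : ZMod p) = form (col p n α r) (segCompl u s.val (s.val + 2)))
    ≠ decide (((c.val : ℕ) : ZMod p) = form (col p n α r) u)
  rw [form_swap (col p n α r) u s t hst hne, ← hu, decide_eq_true (rfl : ((c.val : ℕ) : ZMod p) = _)]
  have hne' : ¬ (((c.val : ℕ) : ZMod p) = ((c.val : ℕ) : ZMod p) +
      (if u s = true then col p n α r t - col p n α r s else col p n α r s - col p n α r t)) := by
    intro h
    have h0 : (if u s = true then col p n α r t - col p n α r s else col p n α r s - col p n α r t) = 0 :=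
      add_left_cancel (h.symm.trans (add_zero _).symm)
    rcases Bool.eq_false_or_eq_true (u s) with hus | hus
    · rw [if_pos hus] at h0; exact hd h0
    · rw [if_neg (by rw [hus]; exact Bool.false_ne_true)] at h0
      exact hd (by rw [← neg_sub, h0, neg_zero])
  rw [decide_eq_false hne']
  exact Bool.false_ne_true

/-- **swap mass of `fieldY`**: at a pair `(s, s+1)` where column `r` jumps, `2·swapMass(s) ≥ K·2ⁿ` — each input with `u_s ≠ u_{s+1}` is
swap-sensitive for the `K` cuts of column `r` whose residue is `col_r · u`. -/
theorem swapMass_fieldY_ge (n K : ℕ) (hbig : p * (NullDial.sepM p n + (rk n + 1) * (K + 2)) ≤ n + 1) (α : GaloisField p (rk n))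
    (r : Fin (rk n + 1)) (s t : Fin n) (hst : t.val = s.val + 1) (hd : col p n α r t - col p n α r s ≠ 0) :
    K * 2 ^ n ≤ 2 * swapMass (fieldY p n α) s.val := by
  classical
  haveI : NeZero p := ⟨hp.out.ne_zero⟩
  have hst' : s ≠ t := fun h => by rw [h] at hst; omega
  set A := univ.filter fun u : Fin n → Bool => u s ≠ u t with hA
  -- the `K` cuts of column `r` accepting `u`
  set G : (Fin n → Bool) → Finset (Fin (n + 1)) := fun u =>
    univ.image fun k : Fin K => cutAt p n K hbig r k ⟨(form (col p n α r) u).val, ZMod.val_lt _⟩ with hG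
  have hGcard : ∀ u, (G u).card = K := by
    intro u
    rw [hG, card_image_of_injective _ (cutAt_injective p n K hbig r _), card_univ, Fintype.card_fin]
  -- (1) per cut: the inputs of `A` accepted by a cut of `G u` are swap-sensitive there
  have h1 : ∀ g : Fin (n + 1), (A.filter fun u => g ∈ G u).card ≤ swapInf (fieldY p n α) g s.val := by
    intro g
    refine card_le_card fun u hu => ?_
    rw [mem_filter] at hu
    rcases hu with ⟨huA, hg⟩
    rw [hA, mem_filter] at huA
    rw [hG, mem_image] at hg
    rcases hg with ⟨k, -, hk⟩
    refine mem_filter.2 ⟨mem_univ _, (neAdj_iff u _).2 ⟨s, t, rfl, hst, huA.2⟩, ?_⟩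
    rw [← hk]
    refine fieldY_flip p n K hbig α r k _ u s t hst huA.2 hd ?_
    show (((form (col p n α r) u).val : ℕ) : ZMod p) = form (col p n α r) u
    exact ZMod.natCast_zmod_val _
  -- (2) exchange the sums
  have h2 : ∑ g : Fin (n + 1), (A.filter fun u => g ∈ G u).card = ∑ u ∈ A, (G u).card := by
    have e1 : ∀ g : Fin (n + 1), (A.filter fun u => g ∈ G u).card = ∑ u ∈ A, if g ∈ G u then 1 else 0 := fun g => card_filter _ _
    simp_rw [e1]
    rw [Finset.sum_comm]
    refine sum_congr rfl fun u _ => ?_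
    rw [← card_filter, Finset.filter_mem_eq_inter, univ_inter]
  have h3 : ∑ u ∈ A, (G u).card = K * A.card := by
    rw [sum_congr rfl fun u _ => hGcard u, sum_const, smul_eq_mul, mul_comm]
  have hmass : K * A.card ≤ swapMass (fieldY p n α) s.val := by
    rw [← h3, ← h2]
    unfold swapMass
    exact sum_le_sum fun g _ => h1 g
  have hA2 := two_pow_le_two_mul_card_ne s t hst'
  calc K * 2 ^ n ≤ K * (2 * A.card) := Nat.mul_le_mul_left K hA2
    _ = 2 * (K * A.card) := by ring
    _ ≤ 2 * swapMass (fieldY p n α) s.val := Nat.mul_le_mul_left 2 hmass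

/-- **`fieldY` is on the HIGH side of the variation dial** (inlined `¬ LowVar dialB`: fewer than half the positions have swap mass
`≤ 4(log₂ n + 1)·2ⁿ`; in fact at most one does) for `α ∉ {0,1}`, once the `K = 8(log₂ n + 1) + 1` cuts per column fit. -/
theorem not_low_fieldY (n K : ℕ) (hbig : p * (NullDial.sepM p n + (rk n + 1) * (K + 2)) ≤ n + 1)
    (hK : 2 * (4 * (Nat.log 2 n + 1)) + 1 ≤ K) (hn : 3 ≤ n) (α : GaloisField p (rk n)) (h0 : α ≠ 0) (h1 : α ≠ 1) :
    ¬ (n ≤ 2 * (lowPositions n (fieldY p n α) (4 * (Nat.log 2 n + 1))).card) := by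
  intro hlow
  have hsub : lowPositions n (fieldY p n α) (4 * (Nat.log 2 n + 1)) ⊆ {n - 1} := by
    intro i hi
    rcases mem_filter.1 hi with ⟨hir, hmass⟩
    rw [mem_range] at hir
    rw [mem_singleton]
    by_contra hne
    have hi1 : i + 1 < n := by omega
    obtain ⟨r, hr⟩ := exists_col_jump p n α h0 h1 ⟨i, hir⟩ ⟨i + 1, hi1⟩ rfl
    have h : K * 2 ^ n ≤ 2 * swapMass (fieldY p n α) i := swapMass_fieldY_ge p n K hbig α r ⟨i, hir⟩ ⟨i + 1, hi1⟩ rfl hr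
    have h2n : 0 < 2 ^ n := Nat.two_pow_pos n
    have h3 : (2 * (4 * (Nat.log 2 n + 1)) + 1) * 2 ^ n ≤ K * 2 ^ n := Nat.mul_le_mul_right _ hK
    have h4 : 2 * swapMass (fieldY p n α) i ≤ 2 * (4 * (Nat.log 2 n + 1) * 2 ^ n) := Nat.mul_le_mul_left 2 hmass
    have e : (2 * (4 * (Nat.log 2 n + 1)) + 1) * 2 ^ n = 2 * (4 * (Nat.log 2 n + 1) * 2 ^ n) + 2 ^ n := by ring
    omega
  have := card_le_card hsub
  rw [card_singleton] at this
  omega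

end High

/-! #### (8) genericity gives `α ∉ {0, 1}`; the budgets hold eventually; the combined statement -/
section Combined
variable (p : ℕ) [hp : Fact p.Prime]
open SegMove

/-- a generic `α` is non-zero (level `m = 1`, `B = {0}`). -/
theorem generic_ne_zero (n : ℕ) (hn : 2 ≤ n) (α : GaloisField p (rk n))
    (hα : ∀ m : ℕ, 1 ≤ m → m ≤ Nat.log 2 n → ∀ B : Finset (Fin n), B.card = m →
      ∃ r : Fin (rk n), r.val < (m + 1) * (Nat.log 2 n + 1) ∧ coord p n (∑ i ∈ B, α ^ (i.val + 1)) r ≠ 0) : α ≠ 0 := by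
  intro h
  have hL : 1 ≤ Nat.log 2 n := Nat.log_pos (by norm_num) (by omega)
  obtain ⟨r, -, hr⟩ := hα 1 le_rfl hL {⟨0, by omega⟩} (card_singleton _)
  apply hr
  rw [sum_singleton, h, zero_pow (Nat.succ_ne_zero _)]
  unfold coord
  rw [map_zero, Finsupp.zero_apply]

/-- a generic `α` is not `1` once `p ≤ log₂ n` (level `m = p`: `p` ones sum to `0`). -/
theorem generic_ne_one (n : ℕ) (hpL : p ≤ Nat.log 2 n) (hpn : p ≤ n) (α : GaloisField p (rk n))
    (hα : ∀ m : ℕ, 1 ≤ m → m ≤ Nat.log 2 n → ∀ B : Finset (Fin n), B.card = m →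
      ∃ r : Fin (rk n), r.val < (m + 1) * (Nat.log 2 n + 1) ∧ coord p n (∑ i ∈ B, α ^ (i.val + 1)) r ≠ 0) : α ≠ 1 := by
  intro h
  set B : Finset (Fin n) := (univ : Finset (Fin p)).map (Fin.castLEEmb hpn) with hB
  have hBc : B.card = p := by rw [hB, card_map, card_univ, Fintype.card_fin]
  obtain ⟨r, -, hr⟩ := hα p hp.out.one_lt.le hpL B hBc
  apply hr
  have hs : ∑ i ∈ B, α ^ (i.val + 1) = 0 := by
    rw [sum_congr rfl fun i _ => by rw [h, one_pow], sum_const, hBc, nsmul_eq_mul, mul_one]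
    exact CharP.cast_eq_zero _ p
  rw [hs]
  unfold coord
  rw [map_zero, Finsupp.zero_apply]

omit hp in
/-- the HIGH-side budget holds eventually: `p·(sepM + (R+1)(8 log₂ n + 13)) ≤ n + 1` for `n ≥ n₀(p)`. -/
theorem eventually_big : ∃ n₀ : ℕ, ∀ n ≥ n₀,
    p * (NullDial.sepM p n + (rk n + 1) * ((2 * (4 * (Nat.log 2 n + 1)) + 1) + 2)) ≤ n + 1 := by
  obtain ⟨N₀, hN₀⟩ := DWalk.const_mul_logPow_le' (150 * p) 3
  refine ⟨max N₀ 2, fun n hn => ?_⟩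
  have h1 := hN₀ n (le_trans (le_max_left _ _) hn)
  have hL : 1 ≤ Nat.log 2 n := Nat.log_pos (by norm_num) (by have := le_trans (le_max_right _ _) hn; omega)
  set L := Nat.log 2 n with hLdef
  have h2 : (rk n + 1) * ((2 * (4 * (L + 1)) + 1) + 2) ≤ 100 * L ^ 3 := by
    unfold rk
    rw [← hLdef]
    have : ((L + 1) ^ 2 + 1) ≤ 5 * L ^ 2 := by nlinarith
    have : (2 * (4 * (L + 1)) + 1) + 2 ≤ 19 * L := by omega
    calc ((L + 1) ^ 2 + 1) * ((2 * (4 * (L + 1)) + 1) + 2) ≤ (5 * L ^ 2) * (19 * L) := Nat.mul_le_mul ‹_› ‹_›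
      _ = 95 * L ^ 3 := by ring
      _ ≤ 100 * L ^ 3 := by omega
  have h3 := NullDial.p_mul_sepM_le p n
  have h4 : p * ((rk n + 1) * ((2 * (4 * (L + 1)) + 1) + 2)) ≤ p * (100 * L ^ 3) := Nat.mul_le_mul_left _ h2
  have h5 : 3 * (p * (100 * L ^ 3)) = 2 * (150 * p * L ^ 3) := by ring
  have h6 : 3 * (n / 3) ≤ n := Nat.mul_div_le n 3
  rw [Nat.mul_add]
  omega

omit hp in
/-- `p ≤ log₂ n`, `p ≤ n`, `9 ≤ n` eventually. -/
theorem eventually_misc : ∃ n₀ : ℕ, ∀ n ≥ n₀, p ≤ Nat.log 2 n ∧ p ≤ n ∧ 9 ≤ n := by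
  refine ⟨max (2 ^ p) 9, fun n hn => ⟨?_, ?_, le_trans (le_max_right _ _) hn⟩⟩
  · have h : 2 ^ p ≤ n := le_trans (le_max_left _ _) hn
    exact (Nat.le_log_iff_pow_le (by norm_num) (by have := Nat.one_le_two_pow (n := p); omega)).2 h
  · exact le_trans (Nat.lt_two_pow_self).le (le_trans (le_max_left _ _) hn)

/-- ★★★ **`fieldY` beyond the four known dials, robustly, and on the HIGH side** (every prime `p ≥ 5`, all `n ≥ n₀(p)`): there is an
`α` such that `fieldY p n α` (i) is `log₂ n`-junta ⊕ one-form presentable (canonically junta-free), (ii) is on the HIGH side of the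
variation dial at threshold `4(log₂ n + 1)` (inlined `¬ LowVar dialB`), and (iii) in EVERY `log₂ n`-junta presentation escapes BOTH the
sparse-free-set dial's hypothesis and the masked-block (hence block- and null-) dial's hypothesis, each inlined verbatim.  What is NOT
here: the robust RANK escape (`¬ SpanHyp`, node §10.4 (c)) — the one remaining input for membership of `fieldY` in the hypothesis class of
the fifth residual `RES⁵`. -/
theorem fieldY_high_sparse_mask_eventually (h5 : 5 ≤ p) : ∃ n₀ : ℕ, ∀ n ≥ n₀, ∃ α : GaloisField p (rk n),
    (fieldData p n α).strat = fieldY p n α ∧ (∀ g, ((fieldData p n α).J g).card ≤ Nat.log 2 n) ∧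
    ¬ (n ≤ 2 * (lowPositions n (fieldY p n α) (4 * (Nat.log 2 n + 1))).card) ∧
    ∀ D : JLinData p n, D.strat = fieldY p n α → (∀ g, (D.J g).card ≤ Nat.log 2 n) →
      ¬ (∃ S : Finset (Fin n), Nat.log 2 n ≤ S.card ∧
          ∀ g, (S.filter fun i => i ∈ D.J g ∨ D.a g i ≠ 0).card ≤ Nat.sqrt S.card) ∧
      ¬ (∃ (ℓ m M : ℕ) (S : Fin M → ℕ) (Z : Finset (Fin n)), (m % 3 = 1 ∨ m % 3 = 2) ∧
          ((∀ k k' : Fin M, k < k' → S k + ℓ ≤ S k') ∧ (∀ k : Fin M, S k + ℓ ≤ n)) ∧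
          (∀ k : Fin M, (zblk ℓ S Z k).card = m) ∧
          2 ^ m * ((Nat.log 2 n + 1) * (Nat.log 2 n + 1) + 1) ≤ M ∧
            ∀ g (k : Fin M), ∑ i ∈ zblk ℓ S Z k, D.a g i = 0) := by
  obtain ⟨n₁, hn₁⟩ := eventually_fits p
  obtain ⟨n₂, hn₂⟩ := eventually_big p
  obtain ⟨n₃, hn₃⟩ := eventually_misc p
  refine ⟨max n₁ (max n₂ n₃), fun n hn => ?_⟩
  have hfit := hn₁ n (le_trans (le_max_left _ _) hn)
  have hbig := hn₂ n (le_trans (le_trans (le_max_left _ _) (le_max_right _ _)) hn)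
  obtain ⟨hpL, hpn, hn9⟩ := hn₃ n (le_trans (le_trans (le_max_right _ _) (le_max_right _ _)) hn)
  obtain ⟨α, hα⟩ := exists_generic p n (by omega)
  have h0 : α ≠ 0 := generic_ne_zero p n (by omega) α hα
  have h1 : α ≠ 1 := generic_ne_one p n hpL hpn α hα
  have hL2 : 2 ≤ Nat.log 2 n := le_trans (by omega) hpL
  refine ⟨α, fieldData_strat p n α, fun g => by rw [fieldData_J]; exact Nat.zero_le _,
    not_low_fieldY p n _ hbig le_rfl (by omega) α h0 h1, fun D hD hJ => ⟨?_, ?_⟩⟩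
  · exact field_not_sparse p n hfit hL2 α D hD
  · exact field_not_mask p n hfit α hα D hD hJ

end Combined

end Summit.QuantumAdvantage.AdviceFreeQNC0.JLinPeel.FieldCol
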